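import Summits.QuantumFields.YangMills.Theorems.BalabanUVNodesN11DiagonalInductionLawsCoPH
import Summits.QuantumFields.YangMills.Theorems.BalabanUVNodesN11DiagonalOldBranchMeasurable
import Literature.MathematicalPhysics.QuantumFieldTheory.Balaban1983to89.Node00.Record13CoreAtTheta13LiveOfRecord

/-!
# DAG node N11 — THEOREM 1 OF [III] ALONG THE WHOLE LARGE-FIELD DIAGONAL AT THE DOOR OF node00-def-K0a's CURED WITNESS FAMILY WITH THE OLD-BRANCH MEASURABILITY BINDER
# `hmB` DROPPED: from `θ₀.Provisos₁₃Core`, node00-def-T's live-selector clause, `1 ≤ M` and the displayed old-branch BOUND `hCB` per level ONLY (laws: + `0 ≤ g₀, E₀, B₀`) —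
# dag-n11-d's `…N11DiagonalOldBranchMeasurable` §4 (`hmB_of_allLarge`) fed level by level into this seat's diagonal induction `…N11DiagonalInductionCoPH` ∕ `…LawsCoPH`

Cell `pub-ymgap`, YM-PLAN Track A (HUMAN RULING D-0062), seat `pub-ymgap-dag-n11-e` (g13; R134 fan-out row N11∕s3), route `BalabanUVNodes` rev 25 (v1.7 `CoPH` key), item K1⁷
`StabilityBAtRecordR13SepCoPH` = stmt-QuantumFields-20542 (helper lane, count-neutral).  [III] = [Balaban1988Convergent], [IV] = [Balaban1989LargeFieldI].  Over this seat's
`…N11DiagonalInductionCoPH` (p543058) ∕ `…N11DiagonalInductionLawsCoPH` (p549594) and dag-n11-d's `…N11DiagonalOldBranchMeasurable` (kernel measure theory through 11a's operator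
algebra: `hmB_of_allLarge`, `measurable_ζ0_ZrOfRecord₁₃_of_provisosCore`, `measurable_quad_ZrOfRecord₁₃`; bus l.21960 «n11-e: p549594 can drop `hmB` by citing §4»).

WHY THIS FILE.  This seat's diagonal induction at the door `Stage13HParams.ofHistoryBlind (Stage13RParams.ofCured θ₀)` (p543058 §2–§3, with laws p549594 §2–§3) carried, per
level `k < K`, two displayed analytic rows on the OLD branch `U ↦ 𝐓_k(σ_k, ∅)[e^{A_k(σ_k)}](U)`: its measurability `hmB` and a uniform bound `hCB`.  dag-n11-d has now shown `hmB`
IS A THEOREM along the all-large-field diagonal for every `θ : Stage13HParams` whose residual serving the all-large index has measurable `ζ0`, `quad` (`hmB_of_allLarge`: 11a's branch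
operator preserves measurability, the weights are measurable, the operand along the all-large history is `exp(−g₀⁻²A((ω 0).1) − E)`), and that at the door the residual is K0a's
`ZrOfRecord₁₃ θ₀ p` with measurable `ζ0` (from `θ₀.Provisos₁₃Core`, row `tstep.measW`) and `quad ≡ 0`.  The binder in p543058 ∕ p549594 reads the old branch at the index
`σ_k` with the door's weights and the member `S := ∅`; dag-n11-d's three ingredients (`measurable_tkBranchOfRecord_baseCfg`, `measurable_WtOfRecord₁₃H_ζ ∕ _w` over
`measurable_ζ0_ZrOfRecord₁₃_of_provisosCore` ∕ `measurable_quad_ZrOfRecord₁₃`, `measurable_sect2Operand_CoP_of_allLarge`) apply there verbatim.  HENCE: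
§0 `hmB_doorCured_seqAllLarge` — the `hmB` FAMILY of p543058 §2 at the door, every level, every `(t, E)`, from `θ₀.Provisos₁₃Core` + `1 ≤ M` alone.
§1 ★★★ `diag_slotClause_all_doorCured_of_provisosCore_of_liveSel_of_hCB` — THEOREM 1 ALONG THE WHOLE DIAGONAL AT THE DOOR, CLAUSE LEVEL: for every `k ≤ K` term values and a
   constant with the post-𝐑 §2 dichotomy of `ρ_k`'s slot at `σ_k`, from `θ₀.Provisos₁₃Core`, the selector clause of `θ₀`, `1 ≤ M` and `hCB` per level ONLY ·
   `diag_slotClause_succ_forall_terms_doorCured_of_provisosCore_of_liveSel_of_hCB` (above level 0, for EVERY witness — the diagonal is term-free).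
§2 ★★★ `diag_lawsRT_slotClause_all_doorCured_of_provisosCore_of_liveSel_of_hCB` — WITH ITS LAW PACKAGE (`LawsRT … k` of the zero witness; + `0 ≤ g₀, E₀, B₀`).
§3 ★★★ `diag_slotClause_all_doorCured_theta13LiveOfRecord_of_hCB` ∕ ★★★ `diag_lawsRT_slotClause_all_doorCured_theta13LiveOfRecord_of_hCB` — AT THE DOOR OF THE CURED WITNESS OF
   RECORD from `hCB` per level ONLY (+ `0 ≤ g₀` for the laws): the K0-class core conjunct at the witness is a theorem (`Node00.provisos₁₃Core_theta13LiveOfRecord`), the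
   selector clause K0a's `liveRepin₁₃_liveSel`, `M = 1`, `E₀ = B₀ = 1` by the family's numerals.
ONE displayed analytic row is left on the whole diagonal: `hCB`, the located one (a sup bound on the old branch uniform in the field, which runs through `margDensity` of the
exp-mean-log averaging — the tree has absolute continuity only; dag-n11-d l.21898: wants re-typing to joint integrability).

HONEST FRAMING.  Count-neutral kernel bookkeeping: this seat's accepted induction with ONE of its two displayed binder families supplied by dag-n11-d's accepted measurability
theorem (one application per level); `hCB` stays DISPLAYED verbatim; the zero branch of the dichotomy is not excluded; off the diagonal nothing is said (the expansion sequences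
`Ω_{k+1} ≠ ∅` are [III] Sect. 1 ∕ §3 ∕ Thm 2 proper); nothing of Bałaban asserted; N11 NOT discharged; K1⁷ NOT closed; counts unmoved (typed 28∕28 · discharged 5∕27).  One finite
`𝕋⁴_{L^K}` programme at fixed `ε = L^{−K}`; NOT ℝ⁴, NOT OS, NOT a mass gap, NOT Clay.
Sources: [III] Thm 1 p.262, §2 p.262, Theorem p.245, (2.18) p.257, (2.20)–(2.23) p.258, (2.27)–(2.31) pp.259–260, (3.16)–(3.20) pp.268–269, (3.24)–(3.25) p.270, (1.11) p.248;
[IV] (0.3)–(0.4) p.176, p.177 (i)–(ii); [Balaban1987RG1] (0.20) p.256.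
-/

noncomputable section

open MeasureTheory
open scoped BigOperators Matrix.Norms.L2Operator

namespace Summit.QuantumFields.YangMills.Theorems.BalabanUVNodesN11DiagonalInductionHCBCoPH

open Literature.MathematicalPhysics.QuantumFieldTheory.Balaban1983to89 T4Continuum Node00 Node00.Tk DagBinding
open Literature.MathematicalPhysics.QuantumFieldTheory.Balaban1983to89.B16RLeafRecord13AtLive (liveRepin₁₃_liveSel)
open BalabanUVNodesN11TkOpMeasurable (measurable_tkBranchOfRecord_baseCfg)
open BalabanUVNodesN11DiagonalOldBranchMeasurable (measurable_ζ0_ZrOfRecord₁₃_of_provisosCore measurable_quad_ZrOfRecord₁₃ measurable_WtOfRecord₁₃H_ζ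
  measurable_WtOfRecord₁₃H_w measurable_sect2Operand_CoP_of_allLarge)
open BalabanUVNodesN11DiagonalInductionCoPH (diag_slotClause_all_doorCured_of_provisosCore_of_liveSel diag_slotClause_succ_forall_terms_doorCured_of_provisosCore_of_liveSel)
open BalabanUVNodesN11DiagonalInductionLawsCoPH (diag_lawsRT_slotClause_all_doorCured_of_provisosCore_of_liveSel)

variable {F : T4Family} {N : ℕ} [NeZero N]

/-! ## §0. The old-branch measurability family of the diagonal induction at the door — a theorem (dag-n11-d §4) -/

section DoorCured

variable (θ₀ : Stage13Params F N) (p : B12.RunParams)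

/-- **THE `hmB` FAMILY OF THIS SEAT's DIAGONAL INDUCTION AT THE DOOR OF K0a's CURED WITNESS FAMILY IS A THEOREM** — every level `k`, every `(t, E)`: the old branch
`U₀ ↦ 𝐓_k(σ_k, ∅)[e^{A_k(σ_k)}](U₀)` at the door's weights and residual is measurable, from `θ₀.Provisos₁₃Core` and `1 ≤ M` alone (dag-n11-d's `hmB_of_allLarge` argument read at
`σ_k` itself: `measurable_tkBranchOfRecord_baseCfg` — 11a's branch operator preserves measurability; the door's residual serving any index is `ZrOfRecord₁₃ θ₀ p`, measurable `ζ0` by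
`measurable_ζ0_ZrOfRecord₁₃_of_provisosCore`, `quad ≡ 0`, so the weights are measurable (`measurable_WtOfRecord₁₃H_ζ ∕ _w`); the operand along the all-large history is
`exp(−g₀⁻²A((ω 0).1) − E)`, `measurable_sect2Operand_CoP_of_allLarge`). [cite: Balaban1988Convergent, (2.18) p.257, (2.20)–(2.23) p.258, (3.16) p.268, (3.24) p.270, (1.11) p.248] -/
theorem hmB_doorCured_seqAllLarge (h : θ₀.Provisos₁₃Core F N) (hM : 1 ≤ θ₀.τ9.M) (k : ℕ)
    (t : Sect2.TermValues (F.P p.K) (MatA N) (FluctV N) θ₀.τ9.M) (E : ℝ) :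
    Measurable fun U₀ : GaugeField (F.P p.K) k (SU N) =>
      tkBranchOfRecord F N (FluctV N) θ₀.ν θ₀.τ9.M _ p.K
        (WtOfRecord₁₃H F N (Stage13HParams.ofHistoryBlind F N (Stage13RParams.ofCured F N θ₀)) p
          (seqAllLargeOfRecord F θ₀.ν θ₀.τ9.M (gOfRecord₁₃ F N θ₀ p) p.K k))
        (seqAllLargeOfRecord F θ₀.ν θ₀.τ9.M (gOfRecord₁₃ F N θ₀ p) p.K k) (fun _ => ∅) k
        (fun ω => sect2Operand F N (FluctV N) p.K (settingOfRecord₁₃ F N θ₀ p)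
          ((Stage13HParams.ofHistoryBlind F N (Stage13RParams.ofCured F N θ₀)).rzAt p (seqAllLargeOfRecord F θ₀.ν θ₀.τ9.M (gOfRecord₁₃ F N θ₀ p) p.K k))
          (seqAllLargeOfRecord F θ₀.ν θ₀.τ9.M (gOfRecord₁₃ F N θ₀ p) p.K k) t E
          (UbgOfRecord₁₃CoP F N θ₀ p k (seqAllLargeOfRecord F θ₀.ν θ₀.τ9.M (gOfRecord₁₃ F N θ₀ p) p.K k))
          ((fun _ => ∅ : ℕ → Set (Site (F.P p.K) 0)), fun j => (ω j).2) (fun j => (ω j).1))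
        (baseCfg (V := FluctV N) k U₀) :=
  -- dag-n11-d's `hmB_of_allLarge` argument read at `σ_k` itself: 11a's branch operator preserves measurability (`measurable_tkBranchOfRecord_baseCfg`), the door's weights are
  -- measurable (residual `ZrOfRecord₁₃ θ₀ p`: `ζ0` by row `tstep.measW`, `quad ≡ 0`), the operand along the all-large history is `exp(−g₀⁻²A((ω 0).1) − E)`
  measurable_tkBranchOfRecord_baseCfg F N (FluctV N) θ₀.ν θ₀.τ9.M _ p.K
    (WtOfRecord₁₃H F N (Stage13HParams.ofHistoryBlind F N (Stage13RParams.ofCured F N θ₀)) p (seqAllLargeOfRecord F θ₀.ν θ₀.τ9.M (gOfRecord₁₃ F N θ₀ p) p.K k))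
    (fun j Y => measurable_WtOfRecord₁₃H_ζ (Stage13HParams.ofHistoryBlind F N (Stage13RParams.ofCured F N θ₀)) p _ j Y
      (measurable_ζ0_ZrOfRecord₁₃_of_provisosCore h j Y))
    (fun j Λ' Y S' => measurable_WtOfRecord₁₃H_w (Stage13HParams.ofHistoryBlind F N (Stage13RParams.ofCured F N θ₀)) p _ j Λ' Y S'
      (measurable_quad_ZrOfRecord₁₃ j Λ'))
    (seqAllLargeOfRecord F θ₀.ν θ₀.τ9.M (gOfRecord₁₃ F N θ₀ p) p.K k) (fun _ => ∅) k
    (measurable_sect2Operand_CoP_of_allLarge θ₀ p hM (seqAllLargeOfRecord F θ₀.ν θ₀.τ9.M (gOfRecord₁₃ F N θ₀ p) p.K k) (fun _ _ _ => rfl) _ t E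
      (fun _ => ∅))

/-! ## §1. Theorem 1 along the whole diagonal at the door — clause level, `hCB` only -/

/-- **★★★ THEOREM 1 ALONG THE LARGE-FIELD DIAGONAL AT THE DOOR OF THE CURED FAMILY, `hmB` DROPPED** — for every `k ≤ K` the post-𝐑 slot of `ρ_k` at `σ_k` has the §2 dichotomy
at the door's residual and weights, from `θ₀.Provisos₁₃Core`, node00-def-T's live-selector clause of `θ₀`, `1 ≤ M` and the DISPLAYED uniform bound `hCB` of the old branch per level
ONLY (this seat's p543058 `diag_slotClause_all_doorCured_of_provisosCore_of_liveSel` with its `hmB` family supplied by §0). [cite: Balaban1988Convergent, Thm 1 p.262, Theorem p.245, (3.24)–(3.25) p.270, (2.18) p.257, (1.11) p.248, (3.16)–(3.20) pp.268–269; Balaban1989LargeFieldI, (0.3) p.176, p.177 (i)–(ii)] -/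
theorem diag_slotClause_all_doorCured_of_provisosCore_of_liveSel_of_hCB (h : θ₀.Provisos₁₃Core F N)
    (hsel : θ₀.ppSel = ppSelLiveOfRecord F N θ₀.ν θ₀.τ9 (EOfRecord₁₃ F N θ₀) (wOfRecord₉ F N θ₀.toStage9Params)) (hM : 1 ≤ θ₀.τ9.M) (C : ℕ → ℝ)
    (hCB : ∀ k, k < p.K → ∀ (t : Sect2.TermValues (F.P p.K) (MatA N) (FluctV N) θ₀.τ9.M) (E : ℝ) (U₀ : GaugeField (F.P p.K) k (SU N)),
      |tkBranchOfRecord F N (FluctV N) θ₀.ν θ₀.τ9.M _ p.K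
          (WtOfRecord₁₃H F N (Stage13HParams.ofHistoryBlind F N (Stage13RParams.ofCured F N θ₀)) p
            (seqAllLargeOfRecord F θ₀.ν θ₀.τ9.M (gOfRecord₁₃ F N θ₀ p) p.K k))
          (seqAllLargeOfRecord F θ₀.ν θ₀.τ9.M (gOfRecord₁₃ F N θ₀ p) p.K k) (fun _ => ∅) k
          (fun ω => sect2Operand F N (FluctV N) p.K (settingOfRecord₁₃ F N θ₀ p)
            ((Stage13HParams.ofHistoryBlind F N (Stage13RParams.ofCured F N θ₀)).rzAt p (seqAllLargeOfRecord F θ₀.ν θ₀.τ9.M (gOfRecord₁₃ F N θ₀ p) p.K k))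
            (seqAllLargeOfRecord F θ₀.ν θ₀.τ9.M (gOfRecord₁₃ F N θ₀ p) p.K k) t E
            (UbgOfRecord₁₃CoP F N θ₀ p k (seqAllLargeOfRecord F θ₀.ν θ₀.τ9.M (gOfRecord₁₃ F N θ₀ p) p.K k))
            ((fun _ => ∅ : ℕ → Set (Site (F.P p.K) 0)), fun j => (ω j).2) (fun j => (ω j).1))
          (baseCfg (V := FluctV N) k U₀)| ≤ C k) :
    ∀ k, k ≤ p.K → ∃ (t : Sect2.TermValues (F.P p.K) (MatA N) (FluctV N) θ₀.τ9.M) (E : ℝ),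
      slotsOfRecord F N θ₀.ν θ₀.τ9 (EOfRecord₁₃ F N θ₀) (wOfRecord₉ F N θ₀.toStage9Params) θ₀.ppSel p (gOfRecord₁₃ F N θ₀ p) k
          (seqAllLargeOfRecord F θ₀.ν θ₀.τ9.M (gOfRecord₁₃ F N θ₀ p) p.K k) = 0 ∨
        ∀ᵐ U ∂fieldMeasure (F.P p.K) k (SU N),
          chiSeqOfRecord F N θ₀.ν θ₀.τ9.M (gOfRecord₁₃ F N θ₀ p) p.K k (seqAllLargeOfRecord F θ₀.ν θ₀.τ9.M (gOfRecord₁₃ F N θ₀ p) p.K k) U ≠ 0 →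
            slotsOfRecord F N θ₀.ν θ₀.τ9 (EOfRecord₁₃ F N θ₀) (wOfRecord₉ F N θ₀.toStage9Params) θ₀.ppSel p (gOfRecord₁₃ F N θ₀ p) k
                (seqAllLargeOfRecord F θ₀.ν θ₀.τ9.M (gOfRecord₁₃ F N θ₀ p) p.K k) U =
              sect2Slot F N (FluctV N) p.K (settingOfRecord₁₃ F N θ₀ p)
                ((Stage13HParams.ofHistoryBlind F N (Stage13RParams.ofCured F N θ₀)).rzAt p (seqAllLargeOfRecord F θ₀.ν θ₀.τ9.M (gOfRecord₁₃ F N θ₀ p) p.K k))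
                (WtOfRecord₁₃H F N (Stage13HParams.ofHistoryBlind F N (Stage13RParams.ofCured F N θ₀)) p
                  (seqAllLargeOfRecord F θ₀.ν θ₀.τ9.M (gOfRecord₁₃ F N θ₀ p) p.K k))
                (seqAllLargeOfRecord F θ₀.ν θ₀.τ9.M (gOfRecord₁₃ F N θ₀ p) p.K k) t E
                (UbgOfRecord₁₃CoP F N θ₀ p k (seqAllLargeOfRecord F θ₀.ν θ₀.τ9.M (gOfRecord₁₃ F N θ₀ p) p.K k)) U :=
  diag_slotClause_all_doorCured_of_provisosCore_of_liveSel θ₀ p h hsel hM C (fun k _ t E => hmB_doorCured_seqAllLarge θ₀ p h hM k t E) hCB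

/-- **… AND ABOVE LEVEL 0 FOR EVERY TERM-VALUE WITNESS, `hmB` DROPPED** (the diagonal is term-free). [cite: Balaban1988Convergent, Thm 1 p.262, (2.20)–(2.23) p.258, (3.24)–(3.25) p.270; Balaban1989LargeFieldI, (0.3) p.176, p.177 (i)–(ii)] -/
theorem diag_slotClause_succ_forall_terms_doorCured_of_provisosCore_of_liveSel_of_hCB (h : θ₀.Provisos₁₃Core F N)
    (hsel : θ₀.ppSel = ppSelLiveOfRecord F N θ₀.ν θ₀.τ9 (EOfRecord₁₃ F N θ₀) (wOfRecord₉ F N θ₀.toStage9Params)) (hM : 1 ≤ θ₀.τ9.M) (C : ℕ → ℝ)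
    (hCB : ∀ k, k < p.K → ∀ (t : Sect2.TermValues (F.P p.K) (MatA N) (FluctV N) θ₀.τ9.M) (E : ℝ) (U₀ : GaugeField (F.P p.K) k (SU N)),
      |tkBranchOfRecord F N (FluctV N) θ₀.ν θ₀.τ9.M _ p.K
          (WtOfRecord₁₃H F N (Stage13HParams.ofHistoryBlind F N (Stage13RParams.ofCured F N θ₀)) p
            (seqAllLargeOfRecord F θ₀.ν θ₀.τ9.M (gOfRecord₁₃ F N θ₀ p) p.K k))
          (seqAllLargeOfRecord F θ₀.ν θ₀.τ9.M (gOfRecord₁₃ F N θ₀ p) p.K k) (fun _ => ∅) k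
          (fun ω => sect2Operand F N (FluctV N) p.K (settingOfRecord₁₃ F N θ₀ p)
            ((Stage13HParams.ofHistoryBlind F N (Stage13RParams.ofCured F N θ₀)).rzAt p (seqAllLargeOfRecord F θ₀.ν θ₀.τ9.M (gOfRecord₁₃ F N θ₀ p) p.K k))
            (seqAllLargeOfRecord F θ₀.ν θ₀.τ9.M (gOfRecord₁₃ F N θ₀ p) p.K k) t E
            (UbgOfRecord₁₃CoP F N θ₀ p k (seqAllLargeOfRecord F θ₀.ν θ₀.τ9.M (gOfRecord₁₃ F N θ₀ p) p.K k))
            ((fun _ => ∅ : ℕ → Set (Site (F.P p.K) 0)), fun j => (ω j).2) (fun j => (ω j).1))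
          (baseCfg (V := FluctV N) k U₀)| ≤ C k)
    (k : ℕ) (hk : k < p.K) (t' : Sect2.TermValues (F.P p.K) (MatA N) (FluctV N) θ₀.τ9.M) :
    ∃ E : ℝ,
      slotsOfRecord F N θ₀.ν θ₀.τ9 (EOfRecord₁₃ F N θ₀) (wOfRecord₉ F N θ₀.toStage9Params) θ₀.ppSel p (gOfRecord₁₃ F N θ₀ p) (k + 1)
          (seqAllLargeOfRecord F θ₀.ν θ₀.τ9.M (gOfRecord₁₃ F N θ₀ p) p.K (k + 1)) = 0 ∨
        ∀ᵐ U ∂fieldMeasure (F.P p.K) (k + 1) (SU N),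
          chiSeqOfRecord F N θ₀.ν θ₀.τ9.M (gOfRecord₁₃ F N θ₀ p) p.K (k + 1) (seqAllLargeOfRecord F θ₀.ν θ₀.τ9.M (gOfRecord₁₃ F N θ₀ p) p.K (k + 1)) U ≠ 0 →
            slotsOfRecord F N θ₀.ν θ₀.τ9 (EOfRecord₁₃ F N θ₀) (wOfRecord₉ F N θ₀.toStage9Params) θ₀.ppSel p (gOfRecord₁₃ F N θ₀ p) (k + 1)
                (seqAllLargeOfRecord F θ₀.ν θ₀.τ9.M (gOfRecord₁₃ F N θ₀ p) p.K (k + 1)) U =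
              sect2Slot F N (FluctV N) p.K (settingOfRecord₁₃ F N θ₀ p)
                ((Stage13HParams.ofHistoryBlind F N (Stage13RParams.ofCured F N θ₀)).rzAt p
                  (seqAllLargeOfRecord F θ₀.ν θ₀.τ9.M (gOfRecord₁₃ F N θ₀ p) p.K (k + 1)))
                (WtOfRecord₁₃H F N (Stage13HParams.ofHistoryBlind F N (Stage13RParams.ofCured F N θ₀)) p
                  (seqAllLargeOfRecord F θ₀.ν θ₀.τ9.M (gOfRecord₁₃ F N θ₀ p) p.K (k + 1)))
                (seqAllLargeOfRecord F θ₀.ν θ₀.τ9.M (gOfRecord₁₃ F N θ₀ p) p.K (k + 1)) t' E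
                (UbgOfRecord₁₃CoP F N θ₀ p (k + 1) (seqAllLargeOfRecord F θ₀.ν θ₀.τ9.M (gOfRecord₁₃ F N θ₀ p) p.K (k + 1))) U :=
  diag_slotClause_succ_forall_terms_doorCured_of_provisosCore_of_liveSel θ₀ p h hsel hM C (fun k _ t E => hmB_doorCured_seqAllLarge θ₀ p h hM k t E) hCB k hk t'

/-! ## §2. … with its law package -/

/-- **★★★ THEOREM 1 ALONG THE LARGE-FIELD DIAGONAL AT THE DOOR WITH ITS LAW PACKAGE, `hmB` DROPPED**: from `θ₀.Provisos₁₃Core`, the selector clause, `1 ≤ M`, `0 ≤ g₀`, `0 ≤ E₀, B₀`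
and the displayed old-branch BOUND `hCB` per level ONLY — for every `k ≤ K`, BOTH conjuncts of the §2 form of `ρ_k` at `σ_k`: the inductive assumptions
`Sect2.LawsRT (sect2TowerOfRecord … σ_k t) lf k` AND the post-𝐑 §2 dichotomy (this seat's p549594 `diag_lawsRT_slotClause_all_doorCured_of_provisosCore_of_liveSel`, `hmB` by §0).
[cite: Balaban1988Convergent, Thm 1 p.262, §2 p.262, Theorem p.245, (3.24)–(3.25) p.270, (2.27)–(2.31) pp.259–260, (1.11) p.248; Balaban1989LargeFieldI, (0.3) p.176, p.177 (i)–(ii); Balaban1987RG1, (0.20) p.256] -/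
theorem diag_lawsRT_slotClause_all_doorCured_of_provisosCore_of_liveSel_of_hCB (h : θ₀.Provisos₁₃Core F N)
    (hg0 : 0 ≤ p.g0) (hE₀ : 0 ≤ θ₀.s2.lf.E₀) (hB₀ : 0 ≤ θ₀.s2.lf.B₀)
    (hsel : θ₀.ppSel = ppSelLiveOfRecord F N θ₀.ν θ₀.τ9 (EOfRecord₁₃ F N θ₀) (wOfRecord₉ F N θ₀.toStage9Params)) (hM : 1 ≤ θ₀.τ9.M) (C : ℕ → ℝ)
    (hCB : ∀ k, k < p.K → ∀ (t : Sect2.TermValues (F.P p.K) (MatA N) (FluctV N) θ₀.τ9.M) (E : ℝ) (U₀ : GaugeField (F.P p.K) k (SU N)),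
      |tkBranchOfRecord F N (FluctV N) θ₀.ν θ₀.τ9.M _ p.K
          (WtOfRecord₁₃H F N (Stage13HParams.ofHistoryBlind F N (Stage13RParams.ofCured F N θ₀)) p
            (seqAllLargeOfRecord F θ₀.ν θ₀.τ9.M (gOfRecord₁₃ F N θ₀ p) p.K k))
          (seqAllLargeOfRecord F θ₀.ν θ₀.τ9.M (gOfRecord₁₃ F N θ₀ p) p.K k) (fun _ => ∅) k
          (fun ω => sect2Operand F N (FluctV N) p.K (settingOfRecord₁₃ F N θ₀ p)
            ((Stage13HParams.ofHistoryBlind F N (Stage13RParams.ofCured F N θ₀)).rzAt p (seqAllLargeOfRecord F θ₀.ν θ₀.τ9.M (gOfRecord₁₃ F N θ₀ p) p.K k))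
            (seqAllLargeOfRecord F θ₀.ν θ₀.τ9.M (gOfRecord₁₃ F N θ₀ p) p.K k) t E
            (UbgOfRecord₁₃CoP F N θ₀ p k (seqAllLargeOfRecord F θ₀.ν θ₀.τ9.M (gOfRecord₁₃ F N θ₀ p) p.K k))
            ((fun _ => ∅ : ℕ → Set (Site (F.P p.K) 0)), fun j => (ω j).2) (fun j => (ω j).1))
          (baseCfg (V := FluctV N) k U₀)| ≤ C k) :
    ∀ k, k ≤ p.K → ∃ (t : Sect2.TermValues (F.P p.K) (MatA N) (FluctV N) θ₀.τ9.M) (E : ℝ),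
      Sect2.LawsRT (sect2TowerOfRecord F N (FluctV N) p.K (settingOfRecord₁₃ F N θ₀ p)
        ((Stage13HParams.ofHistoryBlind F N (Stage13RParams.ofCured F N θ₀)).rzAt p (seqAllLargeOfRecord F θ₀.ν θ₀.τ9.M (gOfRecord₁₃ F N θ₀ p) p.K k))
        (seqAllLargeOfRecord F θ₀.ν θ₀.τ9.M (gOfRecord₁₃ F N θ₀ p) p.K k) t) (settingOfRecord₁₃ F N θ₀ p).lf k ∧
     (slotsOfRecord F N θ₀.ν θ₀.τ9 (EOfRecord₁₃ F N θ₀) (wOfRecord₉ F N θ₀.toStage9Params) θ₀.ppSel p (gOfRecord₁₃ F N θ₀ p) k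
          (seqAllLargeOfRecord F θ₀.ν θ₀.τ9.M (gOfRecord₁₃ F N θ₀ p) p.K k) = 0 ∨
        ∀ᵐ U ∂fieldMeasure (F.P p.K) k (SU N),
          chiSeqOfRecord F N θ₀.ν θ₀.τ9.M (gOfRecord₁₃ F N θ₀ p) p.K k (seqAllLargeOfRecord F θ₀.ν θ₀.τ9.M (gOfRecord₁₃ F N θ₀ p) p.K k) U ≠ 0 →
            slotsOfRecord F N θ₀.ν θ₀.τ9 (EOfRecord₁₃ F N θ₀) (wOfRecord₉ F N θ₀.toStage9Params) θ₀.ppSel p (gOfRecord₁₃ F N θ₀ p) k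
                (seqAllLargeOfRecord F θ₀.ν θ₀.τ9.M (gOfRecord₁₃ F N θ₀ p) p.K k) U =
              sect2Slot F N (FluctV N) p.K (settingOfRecord₁₃ F N θ₀ p)
                ((Stage13HParams.ofHistoryBlind F N (Stage13RParams.ofCured F N θ₀)).rzAt p (seqAllLargeOfRecord F θ₀.ν θ₀.τ9.M (gOfRecord₁₃ F N θ₀ p) p.K k))
                (WtOfRecord₁₃H F N (Stage13HParams.ofHistoryBlind F N (Stage13RParams.ofCured F N θ₀)) p
                  (seqAllLargeOfRecord F θ₀.ν θ₀.τ9.M (gOfRecord₁₃ F N θ₀ p) p.K k))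
                (seqAllLargeOfRecord F θ₀.ν θ₀.τ9.M (gOfRecord₁₃ F N θ₀ p) p.K k) t E
                (UbgOfRecord₁₃CoP F N θ₀ p k (seqAllLargeOfRecord F θ₀.ν θ₀.τ9.M (gOfRecord₁₃ F N θ₀ p) p.K k)) U) :=
  diag_lawsRT_slotClause_all_doorCured_of_provisosCore_of_liveSel θ₀ p h hg0 hE₀ hB₀ hsel hM C (fun k _ t E => hmB_doorCured_seqAllLarge θ₀ p h hM k t E) hCB

end DoorCured

/-! ## §3. At the door of the cured witness of record -/

section DoorCuredRecord

variable (F N)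
variable (p : B12.RunParams)

/-- **★★★ THEOREM 1 ALONG THE LARGE-FIELD DIAGONAL AT THE DOOR OF K0a's CURED WITNESS OF RECORD `Stage13HParams.ofHistoryBlind (Stage13RParams.ofCured (theta13LiveOfRecord F N))`,
`hmB` DROPPED**: from the displayed old-branch BOUND `hCB` per level ONLY (the K0-class core conjunct at the witness is `Node00.provisos₁₃Core_theta13LiveOfRecord`, the
live-selector clause K0a's `liveRepin₁₃_liveSel`, `M = 1` by the family's numerals; no pin, no prefix, no measurability hypothesis) — for every `k ≤ K`, term values and a
constant with the §2 dichotomy of `ρ_k`'s slot at the all-large-field index of length `k`. [cite: Balaban1988Convergent, Thm 1 p.262, Theorem p.245, (3.24)–(3.25) p.270, (1.11) p.248, (3.16)–(3.22) pp.268–269; Balaban1989LargeFieldI, (0.3)–(0.4) p.176, p.177 (i)–(ii)] -/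
theorem diag_slotClause_all_doorCured_theta13LiveOfRecord_of_hCB (C : ℕ → ℝ)
    (hCB : ∀ k, k < p.K → ∀ (t : Sect2.TermValues (F.P p.K) (MatA N) (FluctV N) (theta13LiveOfRecord F N).τ9.M) (E : ℝ) (U₀ : GaugeField (F.P p.K) k (SU N)),
      |tkBranchOfRecord F N (FluctV N) (theta13LiveOfRecord F N).ν (theta13LiveOfRecord F N).τ9.M _ p.K
          (WtOfRecord₁₃H F N (Stage13HParams.ofHistoryBlind F N (Stage13RParams.ofCured F N (theta13LiveOfRecord F N))) p
            (seqAllLargeOfRecord F (theta13LiveOfRecord F N).ν (theta13LiveOfRecord F N).τ9.M (gOfRecord₁₃ F N (theta13LiveOfRecord F N) p) p.K k))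
          (seqAllLargeOfRecord F (theta13LiveOfRecord F N).ν (theta13LiveOfRecord F N).τ9.M (gOfRecord₁₃ F N (theta13LiveOfRecord F N) p) p.K k) (fun _ => ∅) k
          (fun ω => sect2Operand F N (FluctV N) p.K (settingOfRecord₁₃ F N (theta13LiveOfRecord F N) p)
            ((Stage13HParams.ofHistoryBlind F N (Stage13RParams.ofCured F N (theta13LiveOfRecord F N))).rzAt p
              (seqAllLargeOfRecord F (theta13LiveOfRecord F N).ν (theta13LiveOfRecord F N).τ9.M (gOfRecord₁₃ F N (theta13LiveOfRecord F N) p) p.K k))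
            (seqAllLargeOfRecord F (theta13LiveOfRecord F N).ν (theta13LiveOfRecord F N).τ9.M (gOfRecord₁₃ F N (theta13LiveOfRecord F N) p) p.K k) t E
            (UbgOfRecord₁₃CoP F N (theta13LiveOfRecord F N) p k
              (seqAllLargeOfRecord F (theta13LiveOfRecord F N).ν (theta13LiveOfRecord F N).τ9.M (gOfRecord₁₃ F N (theta13LiveOfRecord F N) p) p.K k))
            ((fun _ => ∅ : ℕ → Set (Site (F.P p.K) 0)), fun j => (ω j).2) (fun j => (ω j).1))
          (baseCfg (V := FluctV N) k U₀)| ≤ C k) :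
    ∀ k, k ≤ p.K → ∃ (t : Sect2.TermValues (F.P p.K) (MatA N) (FluctV N) (theta13LiveOfRecord F N).τ9.M) (E : ℝ),
      slotsOfRecord F N (theta13LiveOfRecord F N).ν (theta13LiveOfRecord F N).τ9 (EOfRecord₁₃ F N (theta13LiveOfRecord F N))
          (wOfRecord₉ F N (theta13LiveOfRecord F N).toStage9Params) (theta13LiveOfRecord F N).ppSel p (gOfRecord₁₃ F N (theta13LiveOfRecord F N) p) k
          (seqAllLargeOfRecord F (theta13LiveOfRecord F N).ν (theta13LiveOfRecord F N).τ9.M (gOfRecord₁₃ F N (theta13LiveOfRecord F N) p) p.K k) = 0 ∨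
        ∀ᵐ U ∂fieldMeasure (F.P p.K) k (SU N),
          chiSeqOfRecord F N (theta13LiveOfRecord F N).ν (theta13LiveOfRecord F N).τ9.M (gOfRecord₁₃ F N (theta13LiveOfRecord F N) p) p.K k
              (seqAllLargeOfRecord F (theta13LiveOfRecord F N).ν (theta13LiveOfRecord F N).τ9.M (gOfRecord₁₃ F N (theta13LiveOfRecord F N) p) p.K k) U ≠ 0 →
            slotsOfRecord F N (theta13LiveOfRecord F N).ν (theta13LiveOfRecord F N).τ9 (EOfRecord₁₃ F N (theta13LiveOfRecord F N))
                (wOfRecord₉ F N (theta13LiveOfRecord F N).toStage9Params) (theta13LiveOfRecord F N).ppSel p (gOfRecord₁₃ F N (theta13LiveOfRecord F N) p) k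
                (seqAllLargeOfRecord F (theta13LiveOfRecord F N).ν (theta13LiveOfRecord F N).τ9.M (gOfRecord₁₃ F N (theta13LiveOfRecord F N) p) p.K k) U =
              sect2Slot F N (FluctV N) p.K (settingOfRecord₁₃ F N (theta13LiveOfRecord F N) p)
                ((Stage13HParams.ofHistoryBlind F N (Stage13RParams.ofCured F N (theta13LiveOfRecord F N))).rzAt p
                  (seqAllLargeOfRecord F (theta13LiveOfRecord F N).ν (theta13LiveOfRecord F N).τ9.M (gOfRecord₁₃ F N (theta13LiveOfRecord F N) p) p.K k))
                (WtOfRecord₁₃H F N (Stage13HParams.ofHistoryBlind F N (Stage13RParams.ofCured F N (theta13LiveOfRecord F N))) p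
                  (seqAllLargeOfRecord F (theta13LiveOfRecord F N).ν (theta13LiveOfRecord F N).τ9.M (gOfRecord₁₃ F N (theta13LiveOfRecord F N) p) p.K k))
                (seqAllLargeOfRecord F (theta13LiveOfRecord F N).ν (theta13LiveOfRecord F N).τ9.M (gOfRecord₁₃ F N (theta13LiveOfRecord F N) p) p.K k) t E
                (UbgOfRecord₁₃CoP F N (theta13LiveOfRecord F N) p k
                  (seqAllLargeOfRecord F (theta13LiveOfRecord F N).ν (theta13LiveOfRecord F N).τ9.M (gOfRecord₁₃ F N (theta13LiveOfRecord F N) p) p.K k)) U :=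
  diag_slotClause_all_doorCured_of_provisosCore_of_liveSel_of_hCB (theta13LiveOfRecord F N) p (provisos₁₃Core_theta13LiveOfRecord F N)
    (liveRepin₁₃_liveSel F N (theta13OfFamily F N eps0OfRecord₁₃ _ _ _)) (le_of_eq rfl) C hCB

/-- **★★★ … WITH ITS LAW PACKAGE at the door of the cured witness of record, `hmB` DROPPED**: from the run's `0 ≤ g₀` and `hCB` per level ONLY (core conjunct
`Node00.provisos₁₃Core_theta13LiveOfRecord`; `E₀ = B₀ = 1`, `M = 1` by the family's numerals, the selector clause `liveRepin₁₃_liveSel`) — for every `k ≤ K`, BOTH conjuncts of the §2 form of `ρ_k` at the all-large index of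
length `k`. [cite: Balaban1988Convergent, Thm 1 p.262, §2 p.262, Theorem p.245, (3.24)–(3.25) p.270, (1.11) p.248, (3.16)–(3.22) pp.268–269, (2.27)–(2.31) pp.259–260; Balaban1989LargeFieldI, (0.3)–(0.4) p.176, p.177 (i)–(ii); Balaban1987RG1, (0.20) p.256] -/
theorem diag_lawsRT_slotClause_all_doorCured_theta13LiveOfRecord_of_hCB (hg0 : 0 ≤ p.g0)
    (C : ℕ → ℝ)
    (hCB : ∀ k, k < p.K → ∀ (t : Sect2.TermValues (F.P p.K) (MatA N) (FluctV N) (theta13LiveOfRecord F N).τ9.M) (E : ℝ) (U₀ : GaugeField (F.P p.K) k (SU N)),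
      |tkBranchOfRecord F N (FluctV N) (theta13LiveOfRecord F N).ν (theta13LiveOfRecord F N).τ9.M _ p.K
          (WtOfRecord₁₃H F N (Stage13HParams.ofHistoryBlind F N (Stage13RParams.ofCured F N (theta13LiveOfRecord F N))) p
            (seqAllLargeOfRecord F (theta13LiveOfRecord F N).ν (theta13LiveOfRecord F N).τ9.M (gOfRecord₁₃ F N (theta13LiveOfRecord F N) p) p.K k))
          (seqAllLargeOfRecord F (theta13LiveOfRecord F N).ν (theta13LiveOfRecord F N).τ9.M (gOfRecord₁₃ F N (theta13LiveOfRecord F N) p) p.K k) (fun _ => ∅) k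
          (fun ω => sect2Operand F N (FluctV N) p.K (settingOfRecord₁₃ F N (theta13LiveOfRecord F N) p)
            ((Stage13HParams.ofHistoryBlind F N (Stage13RParams.ofCured F N (theta13LiveOfRecord F N))).rzAt p
              (seqAllLargeOfRecord F (theta13LiveOfRecord F N).ν (theta13LiveOfRecord F N).τ9.M (gOfRecord₁₃ F N (theta13LiveOfRecord F N) p) p.K k))
            (seqAllLargeOfRecord F (theta13LiveOfRecord F N).ν (theta13LiveOfRecord F N).τ9.M (gOfRecord₁₃ F N (theta13LiveOfRecord F N) p) p.K k) t E
            (UbgOfRecord₁₃CoP F N (theta13LiveOfRecord F N) p k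
              (seqAllLargeOfRecord F (theta13LiveOfRecord F N).ν (theta13LiveOfRecord F N).τ9.M (gOfRecord₁₃ F N (theta13LiveOfRecord F N) p) p.K k))
            ((fun _ => ∅ : ℕ → Set (Site (F.P p.K) 0)), fun j => (ω j).2) (fun j => (ω j).1))
          (baseCfg (V := FluctV N) k U₀)| ≤ C k) :
    ∀ k, k ≤ p.K → ∃ (t : Sect2.TermValues (F.P p.K) (MatA N) (FluctV N) (theta13LiveOfRecord F N).τ9.M) (E : ℝ),
      Sect2.LawsRT (sect2TowerOfRecord F N (FluctV N) p.K (settingOfRecord₁₃ F N (theta13LiveOfRecord F N) p)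
        ((Stage13HParams.ofHistoryBlind F N (Stage13RParams.ofCured F N (theta13LiveOfRecord F N))).rzAt p
          (seqAllLargeOfRecord F (theta13LiveOfRecord F N).ν (theta13LiveOfRecord F N).τ9.M (gOfRecord₁₃ F N (theta13LiveOfRecord F N) p) p.K k))
        (seqAllLargeOfRecord F (theta13LiveOfRecord F N).ν (theta13LiveOfRecord F N).τ9.M (gOfRecord₁₃ F N (theta13LiveOfRecord F N) p) p.K k) t)
        (settingOfRecord₁₃ F N (theta13LiveOfRecord F N) p).lf k ∧
     (slotsOfRecord F N (theta13LiveOfRecord F N).ν (theta13LiveOfRecord F N).τ9 (EOfRecord₁₃ F N (theta13LiveOfRecord F N))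
          (wOfRecord₉ F N (theta13LiveOfRecord F N).toStage9Params) (theta13LiveOfRecord F N).ppSel p (gOfRecord₁₃ F N (theta13LiveOfRecord F N) p) k
          (seqAllLargeOfRecord F (theta13LiveOfRecord F N).ν (theta13LiveOfRecord F N).τ9.M (gOfRecord₁₃ F N (theta13LiveOfRecord F N) p) p.K k) = 0 ∨
        ∀ᵐ U ∂fieldMeasure (F.P p.K) k (SU N),
          chiSeqOfRecord F N (theta13LiveOfRecord F N).ν (theta13LiveOfRecord F N).τ9.M (gOfRecord₁₃ F N (theta13LiveOfRecord F N) p) p.K k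
              (seqAllLargeOfRecord F (theta13LiveOfRecord F N).ν (theta13LiveOfRecord F N).τ9.M (gOfRecord₁₃ F N (theta13LiveOfRecord F N) p) p.K k) U ≠ 0 →
            slotsOfRecord F N (theta13LiveOfRecord F N).ν (theta13LiveOfRecord F N).τ9 (EOfRecord₁₃ F N (theta13LiveOfRecord F N))
                (wOfRecord₉ F N (theta13LiveOfRecord F N).toStage9Params) (theta13LiveOfRecord F N).ppSel p (gOfRecord₁₃ F N (theta13LiveOfRecord F N) p) k
                (seqAllLargeOfRecord F (theta13LiveOfRecord F N).ν (theta13LiveOfRecord F N).τ9.M (gOfRecord₁₃ F N (theta13LiveOfRecord F N) p) p.K k) U =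
              sect2Slot F N (FluctV N) p.K (settingOfRecord₁₃ F N (theta13LiveOfRecord F N) p)
                ((Stage13HParams.ofHistoryBlind F N (Stage13RParams.ofCured F N (theta13LiveOfRecord F N))).rzAt p
                  (seqAllLargeOfRecord F (theta13LiveOfRecord F N).ν (theta13LiveOfRecord F N).τ9.M (gOfRecord₁₃ F N (theta13LiveOfRecord F N) p) p.K k))
                (WtOfRecord₁₃H F N (Stage13HParams.ofHistoryBlind F N (Stage13RParams.ofCured F N (theta13LiveOfRecord F N))) p
                  (seqAllLargeOfRecord F (theta13LiveOfRecord F N).ν (theta13LiveOfRecord F N).τ9.M (gOfRecord₁₃ F N (theta13LiveOfRecord F N) p) p.K k))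
                (seqAllLargeOfRecord F (theta13LiveOfRecord F N).ν (theta13LiveOfRecord F N).τ9.M (gOfRecord₁₃ F N (theta13LiveOfRecord F N) p) p.K k) t E
                (UbgOfRecord₁₃CoP F N (theta13LiveOfRecord F N) p k
                  (seqAllLargeOfRecord F (theta13LiveOfRecord F N).ν (theta13LiveOfRecord F N).τ9.M (gOfRecord₁₃ F N (theta13LiveOfRecord F N) p) p.K k)) U) :=
  diag_lawsRT_slotClause_all_doorCured_of_provisosCore_of_liveSel_of_hCB (theta13LiveOfRecord F N) p (provisos₁₃Core_theta13LiveOfRecord F N) hg0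
    zero_le_one zero_le_one (liveRepin₁₃_liveSel F N (theta13OfFamily F N eps0OfRecord₁₃ _ _ _)) (le_of_eq rfl) C hCB

end DoorCuredRecord

end Summit.QuantumFields.YangMills.Theorems.BalabanUVNodesN11DiagonalInductionHCBCoPH

end
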